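import Literature.MathematicalPhysics.QuantumLattice.LatticeGaugeDLR
import Literature.MathematicalPhysics.QuantumLattice.RepLieAlgebra
import Literature.MathematicalPhysics.QuantumFieldTheory.CurvatureGaussianField
import Summits.QuantumFields.YangMills.Theorems.EquipartitionCriticalityFreeEnergyLogCoefficientDefs
import Summits.QuantumFields.YangMills.Theorems.EquipartitionCriticalityFreeEnergyLogCoefficientExpChartBasic
import HarnessLib

/-!
# `EquipartitionPinsProbe` (crux `stmt-QuantumFields-8760`), line `Sketch` — definitions for STUB T_main

Route `EquipartitionCriticality` of `QuantumFields/YangMills`, crux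
`Summit.QuantumFields.YangMills.Theses.EquipartitionCriticality.EquipartitionPinsProbe`, line `Sketch`,
stub `stub_tangentCore` (tangent laws of the rescaled plaquette field of torus-limit states as `β → ∞`).
This file holds the DEFINITIONS shared by the helper files of that stub (no theorem is proved here):

* `lineZ` — the signed straight parallel transport on `ℤ^d` (`m : ℤ` steps; tree `ZdGaugeConfig.line`
  for `m ≥ 0`), `truncSite` (zero the coordinates `≥ k`), `combTransport U x` — the holonomy `G_U(x)`
  of `U` along the **comb path** from `0` to `x ∈ ℤ⁴` (direction `0` first, then `1`, `2`, `3`; signed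
  coordinates allowed), `axialFix U = U^{G_U}` — the **complete axial (comb) gauge** of a configuration
  on `ℤ⁴` (tree `gaugeTransformZd`; Chatterjee arXiv:1602.01222 §9 has the box version, tree
  `AxialGauge.combGauge`/`gaugeFix`), and `shadow e` — the set of sites `y` whose comb path
  traverses the edge `e` (the downstream set of a comb edge; empty for non-comb edges).
* `lieDim r` — the route's `D = dim_ℝ span{X | exp(tX) ∈ r(G) ∀ t}` (an `abbrev` of the inline
  `finrank`), `lieVec r a` (`a : Fin (lieDim r)`) — an orthonormal basis `e_a` of the Lie algebra
  `𝔤_r ⊆ 𝔲(N)` for the Hilbert–Schmidt inner product `Re tr(X Y†)` (the sibling crux's isometric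
  parametrisation `FreeEnergyLogCoefficient.lieIso`, re-indexed by `Fin (lieDim r)` through
  `dimE_eq_finrank`), `lieCoord r M a = Re tr(M e_a†)` — the `a`-th Frobenius coordinate of ANY matrix
  `M` (the coordinates of its orthogonal projection onto `𝔤_r`).
* `linkField r β U e a = √β · Re tr((ρ(Ũ_e) − 1) e_a†)` — the **rescaled gauge-fixed link field**
  (`Ũ = axialFix U`; the LINEAR deviation `ρ(Ũ_e) − 1`, no logarithm), and
  `plaqField r β U p a = (d linkField)_p^a` — the **rescaled plaquette field** `Y^β = dA^β`
  (`plaquetteCurl` per colour), an exactly closed `ℝ^D`-valued `2`-cochain of `ℤ⁴` for every `U`.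

References: S. Chatterjee, arXiv:1602.01222, §§2, 9, 11 (axial gauge, exponential chart);
B. C. Hall, GTM 222 (2015), Def. 3.18 (the Lie algebra of a matrix group). [arXiv160201222] [Hall2015]
-/

noncomputable section

open scoped Matrix
open Literature.Probability.LatticeModels Literature.MathematicalPhysics.QuantumLattice
open Literature.MathematicalPhysics.QuantumFieldTheory

namespace Summit.QuantumFields.YangMills.Theorems.EquipartitionPinsProbe

/-! ### Straight transports, the comb transport and the complete axial gauge on `ℤ⁴` -/

section Comb

variable {d : ℕ} {G : Type} [Group G]

/-- **Signed straight transport**: `lineZ U k m y` is the holonomy of `U` along the straight path from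
`y` to `y + m e_k`, `m ∈ ℤ`: the forward transport `U(y,k) U(y+e_k,k) ⋯ U(y+(m-1)e_k,k)` (tree
`ZdGaugeConfig.line`) for `m ≥ 0`, the inverse of the forward transport from the endpoint `y + m e_k`
back to `y` for `m < 0`. [cite: arXiv160201222, §9] -/
def lineZ (U : LGConfig d G) (k : Fin d) : ℤ → Site d → G
  | Int.ofNat n, y => ZdGaugeConfig.line U k n y
  | Int.negSucc n, y => (ZdGaugeConfig.line U k (n + 1) (y - Pi.single k ((n : ℤ) + 1)))⁻¹

/-- Zero the coordinates `≥ k` of a site: `truncSite k x = (x₀, …, x_{k-1}, 0, …, 0)`, the point where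
the comb path to `x` starts its `k`-th leg. [folklore] -/
def truncSite (k : Fin d) (x : Site d) : Site d := fun j => if j < k then x j else 0

/-- **The comb transport** `G_U(x)`: the holonomy of `U` along the comb path from `0` to `x ∈ ℤ⁴`,
which moves first along `e₀` by `x₀` steps, then along `e₁` by `x₁`, then `e₂`, then `e₃` (signed
steps). Across a comb edge `(x, i)` (`x_j = 0` for `j > i`) one has `G_U(x + eᵢ) = G_U(x) U(x,i)`.
(Chatterjee arXiv:1602.01222 §9, Prop. 9.2, on boxes; here on all of `ℤ⁴`.) [cite: arXiv160201222, §9] -/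
def combTransport (U : LGConfig 4 G) (x : Site 4) : G :=
  lineZ U 0 (x 0) (truncSite 0 x) * lineZ U 1 (x 1) (truncSite 1 x) *
    lineZ U 2 (x 2) (truncSite 2 x) * lineZ U 3 (x 3) (truncSite 3 x)

/-- **The complete axial (comb) gauge** of a configuration on `ℤ⁴`:
`axialFix U (y, j) = G_U(y) U(y,j) G_U(y + e_j)⁻¹` (tree `gaugeTransformZd` by the comb transport);
it is `1` on every comb edge, and its plaquette holonomies are the conjugates `G_U(x) U_p G_U(x)⁻¹`.
[cite: arXiv160201222, §9] -/
def axialFix (U : LGConfig 4 G) : LGConfig 4 G :=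
  gaugeTransformZd (combTransport U) U

/-- **The shadow (downstream set) of an edge in the comb tree**: `y ∈ shadow e` iff the comb path
from `0` to `y` traverses the edge `e = (x, i)` — which forces `e` to be a comb edge (`x_j = 0` for
`j > i`), `y` to agree with `x` in the coordinates `< i`, and `y_i` to lie beyond the edge
(`y_i ≥ x_i + 1` if `x_i ≥ 0`, `y_i ≤ x_i` if `x_i < 0`). Shifting the link `U_e` multiplies
`G_U(y)` on the left by a fixed element exactly for `y` in the shadow; the shadow of a non-comb edge
is empty. [folklore] -/
def shadow (e : Literature.MathematicalPhysics.QuantumLattice.ZdEdge 4) : Set (Site 4) :=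
  {y | (∀ j : Fin 4, e.2 < j → e.1 j = 0) ∧ (∀ j : Fin 4, j < e.2 → y j = e.1 j) ∧
    (0 ≤ e.1 e.2 → e.1 e.2 + 1 ≤ y e.2) ∧ (e.1 e.2 < 0 → y e.2 ≤ e.1 e.2)}

/-- Membership in the shadow is decidable. [folklore] -/
instance instDecidableMemShadow (e : Literature.MathematicalPhysics.QuantumLattice.ZdEdge 4) (y : Site 4) :
    Decidable (y ∈ shadow e) := by
  unfold shadow; rw [Set.mem_setOf_eq]; infer_instance

end Comb

/-! ### Frobenius coordinates on the Lie algebra of `r(G)` -/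

section Lie

variable {G : Type} [Group G] [TopologicalSpace G] (r : LatticeRep G)

/-- The route's number of colours `D = dim_ℝ span{X | exp(tX) ∈ r(G) ∀ t}` (`= dim_ℝ 𝔤_r`,
`finrank_span_eq_finrank_repLieAlgebra`), as an abbreviation of the inline `finrank`. [cite: Hall2015, Definition 3.18] -/
abbrev lieDim : ℕ :=
  Module.finrank ℝ ↥(Submodule.span ℝ {X : Matrix (Fin r.N) (Fin r.N) ℂ |
    ∀ t : ℝ, NormedSpace.exp ((t : ℂ) • X) ∈ Set.range r.ρ})

/-- The chart dimension of the sibling crux equals `lieDim r` (`dimE_eq_finrank`, unitary `r`); the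
registered anchor of this definitions file. [folklore] -/
theorem dimE_eq_lieDim : ∀ {G : Type} [Group G] [TopologicalSpace G] (r : Literature.MathematicalPhysics.QuantumFieldTheory.LatticeRep G), Summit.QuantumFields.YangMills.Theorems.FreeEnergyLogCoefficient.dimE r.ρ = Module.finrank ℝ ↥(Submodule.span ℝ {X : Matrix (Fin r.N) (Fin r.N) ℂ | ∀ t : ℝ, NormedSpace.exp ((t : ℂ) • X) ∈ Set.range r.ρ}) :=
  fun r => FreeEnergyLogCoefficient.dimE_eq_finrank r.ρ r.mem_unitary

/-- **An orthonormal basis `e_a`, `a : Fin D`, of the Lie algebra `𝔤_r ⊆ 𝔲(N)`** for the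
Hilbert–Schmidt inner product `Re tr(X Y†)`: the image of the standard basis of `ℝ^D` under the
isometric parametrisation `FreeEnergyLogCoefficient.lieIso r.ρ`, re-indexed along `dimE_eq_lieDim`.
[cite: arXiv160201222, §11] -/
def lieVec (a : Fin (lieDim r)) : Matrix (Fin r.N) (Fin r.N) ℂ :=
  FreeEnergyLogCoefficient.lieIso r.ρ
    (EuclideanSpace.single (finCongr (dimE_eq_lieDim r).symm a) (1 : ℝ))

/-- **Frobenius coordinates**: `lieCoord r M a = Re tr(M e_a†)`, the `a`-th coordinate of the
orthogonal projection of an arbitrary matrix `M` onto `𝔤_r` (real-linear in `M`; for `M ∈ 𝔤_r`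
these are its coordinates in the basis `e_a`, and `∑_a (lieCoord r M a)² ≤ ‖M‖_F²`). [folklore] -/
def lieCoord (M : Matrix (Fin r.N) (Fin r.N) ℂ) (a : Fin (lieDim r)) : ℝ :=
  (M * (lieVec r a)ᴴ).trace.re

end Lie

/-! ### The rescaled gauge-fixed fields -/

section Field

variable {G : Type} [Group G] [TopologicalSpace G] (r : LatticeRep G)

/-- **The rescaled link field in the comb gauge**:
`linkField r β U e a = √β · Re tr((ρ(Ũ_e) − 1) e_a†)`, `Ũ = axialFix U` — `√β` times the Frobenius
coordinates of the LINEAR deviation from `1` of the gauge-fixed link variable (it vanishes on comb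
edges; no logarithm is taken). [folklore] -/
def linkField (β : ℝ) (U : LGConfig 4 G) (e : Literature.MathematicalPhysics.QuantumLattice.ZdEdge 4) (a : Fin (lieDim r)) : ℝ :=
  Real.sqrt β * lieCoord r (r.ρ (axialFix U e) - 1) a

/-- **The rescaled plaquette field** `Y^β = dA^β`: `plaqField r β U p a = plaquetteCurl (linkField · a) p`,
an `ℝ^D`-valued `2`-cochain of `ℤ⁴` which is closed (`dY = 0` on every `3`-cell) for every `U`, and whose
energy `½|Y_p|²` is `β (N − Re tr ρ(U_p)) + o(1)` in probability as `β → ∞` under equipartition. [folklore] -/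
def plaqField (β : ℝ) (U : LGConfig 4 G) : ZdPlaquette 4 → Fin (lieDim r) → ℝ :=
  fun p a => plaquetteCurl (fun e => linkField r β U e a) p

end Field

end Summit.QuantumFields.YangMills.Theorems.EquipartitionPinsProbe

end
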